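import Literature.MathematicalPhysics.QuantumFieldTheory.Balaban1983to89.B6Ineq2140KLevelV1
import Literature.MathematicalPhysics.QuantumFieldTheory.Balaban1983to89.B3TorusRadialSums
import HarnessLib

/-!
# `Balaban1983to89.B6KLevelCensusBookkeepingV1` — T. Bałaban, *Propagators and renormalization transformations for lattice gauge theories. II*,
Comm. Math. Phys. **96** (1984) 223–250 [Balaban1984PropagatorsII], pp. 232 (2.54), 234 (2.60), 247 (2.137)/(2.140), 249 (2.151): **THE (2.54)/(2.60)
BOOKKEEPING OF THE k-LEVEL CENSUSES** — moving a blockwise bound from the block of a fine bond to an ADJACENT census site (torus distance `≤ 1`: the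
cut-off localisation «supp ζ ⊂ Δ̃(y)» of (2.137)/(2.139)/(2.140)/(2.151)) costs a level-comparison factor on the lengths ((2.60) in level-gap form: two
blocks at torus distance `≤ 1` lie on the same or on consecutive levels, `|j − j′| ≤ 1`, by the tree's `B6Ineq2140KLevelV1.levelGap_le_dist`) and `e^{δ}` on
the decay ((2.54)); plus the `t`-cancellation of the Hölder quotient and the degenerate pair. Shared by the census files `B6Cor28PrintedKLevelV1` (Cor. 2.8),
`B6Prop26Census2137KLevelV1` (Prop. 2.6 (2.137)) and `B6Prop26Census2140KLevelV1` (Prop. 2.6 (2.140)) (B6-CLOSURE §5 items 20–21; fold owner r03).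
IMPORTS ONLY BUILT TREE FILES (no dependence on the Cor. 2.8 core).

HONEST FRAMING (programme rule): statement-level skeleton of published theorems with citation tags; proofs where landed; nothing here
is a claim about the Yang–Mills mass gap.

PRINT (verbatim).  p. 232 (2.54): «d(y, y′) ≦ d(y, y″) + d(y″, y′) + 1»; p. 234 (2.60): «e^{−αδ₀d(y,y′)} ≦ e^{−αδ₀RM max{|j−j′|−1,0}}, y ∈ Λ_j, y′ ∈ Λ_{j′}»;
p. 247: «ζ ∈ C₀^∞(Δ̃(y)) (the cube Δ̃(y) for y ∈ Λ_j is a sum of 2^d unit cubes on the L^{−j}-scale, having y as a corner)»; [4] (1.109) p. 35: the Hölder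
quotient `|x − x′|^{−α}|A(x) − A(x′)|`.

## WHAT THIS FILE CERTIFIES (kernel-checked, sorry-free, standard axioms; THEOREMS ONLY)

* `len_compare` (real-number core: `ℓ_y ≤ Λℓ_z`, `Λ ≥ 1`, `0 ≤ α ≤ 1` ⇒ `ℓ_z^{−α}ℓ_z⁻¹ ≤ Λ²ℓ_y^{−(1+α)}`), `quot_cancel` (`(tℓ)^{−α}(t^αX) = ℓ^{−α}X`);
* **`adjScale_le`** — TWO BLOCKS AT TORUS DISTANCE `≤ 1` LIE ON THE SAME OR ON CONSECUTIVE LEVELS (`j(z) ≤ j(y) + 1` and `j(y) ≤ j(z) + 1`) under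
  `R·L·M_h ≥ 2L` ((2.60) in the level-gap form `(R·L·M_h − 1)·(|j − j′| − 1)₊ ≤ d_T`); hence **`adjLen_le_L`** (`ℓ_z ≤ L·ℓ_y`), **`adjLen_pow_le`**
  (`ℓ_z^p ≤ L^p·ℓ_y^p`, the (2.136)/(2.140) prefactors), **`adjLen_le`** (`ℓ_z^{−α}ℓ_z⁻¹ ≤ (L²e)²·ℓ_y^{−(1+α)}`, the (2.151) prefactor — constant kept as
  first landed in the Cor. 2.8 census), **`adjLen_rpow_le`** (`ℓ_z^{1−α} ≤ (L·e)·ℓ_y^{1−α}`, the (2.137) prefactor) for `ℓ_• = len_T(•)·|c_f|⁻¹`;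
  **`exp_adj_le`** — (2.54) for an adjacent block: `e^{−δ d_T(z,w)} ≤ e^{δ}e^{−δ d_T(y,w)}`; `eq_of_supDist_eq_zero` — bonds of the same direction at
  `ℓ^∞`-distance `0` coincide.

HONEST SCOPE: bookkeeping only, no inequality of print beyond (2.54)/(2.60) in the V1 torus reading (p21՚s `geomT`).  NOT summit progress.
Unit `lit-balaban-r03` (gens 25–26), 2026-08-24 (the lemmas were first written inside the Cor. 2.8 census by gen 25; moved here by gen 26 to be shared,
and re-proved from the tree's level-gap inequality so that the file imports built modules only).
-/

noncomputable section

namespace Literature.MathematicalPhysics.QuantumFieldTheory.Balaban1983to89.B6KLevelCensusBookkeepingV1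

open LatticeFieldCalculus
open B6MultiLevelBoxOperator (N0)
open B6MultiLevelTorusOperator (TDomains)
open B6GlobalChartV1 (PV domT blkV1)
open B6Geom246MultiLevelBox (bset)
open B6Geom246MultiLevelTorus (geomT triangle_refl_nonneg_T)
open B8Ineq192MultiLevelTorus (lenT_eq lenT_pos symmT)
open B6Ineq2140KLevelV1 (levelGap_le_dist)
open B3TorusRadialSums (supDist_eq_zero_iff)

variable {d ℓ : ℕ} {hd : 1 ≤ d + 1} {hL : Odd (ℓ + 1) ∧ 1 < ℓ + 1}

/-- **two blocks with comparable lengths** — generic real-number core: if `ℓ_y ≤ Λ·ℓ_z` with `Λ ≥ 1` then `ℓ_z^{−α}·ℓ_z⁻¹ ≤ Λ²·ℓ_y^{−(1+α)}`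
(`0 ≤ α ≤ 1`). [cite: Balaban1984PropagatorsII, (2.60) p.234, bookkeeping] -/
theorem len_compare {ℓz ℓy Λ α : ℝ} (hz : 0 < ℓz) (hy : 0 < ℓy) (hΛ : 1 ≤ Λ) (hyz : ℓy ≤ Λ * ℓz) (hα0 : 0 ≤ α) (hα1 : α ≤ 1) :
    ℓz ^ (-α) * ℓz⁻¹ ≤ Λ ^ 2 * ℓy ^ (-(1 + α)) := by
  have hΛ0 : 0 < Λ := by linarith
  have hq : ℓy / Λ ≤ ℓz := by rw [div_le_iff₀ hΛ0]; linarith [mul_comm Λ ℓz]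
  have hq0 : 0 < ℓy / Λ := div_pos hy hΛ0
  -- `ℓ_z^{−α} ≤ (ℓ_y/Λ)^{−α} = ℓ_y^{−α}·Λ^{α} ≤ ℓ_y^{−α}·Λ`
  have h1 : ℓz ^ (-α) ≤ ℓy ^ (-α) * Λ := by
    calc ℓz ^ (-α) ≤ (ℓy / Λ) ^ (-α) := Real.rpow_le_rpow_of_nonpos hq0 hq (by linarith)
      _ = ℓy ^ (-α) * Λ ^ α := by
          rw [Real.div_rpow hy.le hΛ0.le, Real.rpow_neg hΛ0.le, div_inv_eq_mul]
      _ ≤ ℓy ^ (-α) * Λ := by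
          refine mul_le_mul_of_nonneg_left ?_ (Real.rpow_nonneg hy.le _)
          calc Λ ^ α ≤ Λ ^ (1 : ℝ) := Real.rpow_le_rpow_of_exponent_le hΛ hα1
            _ = Λ := Real.rpow_one Λ
  -- `ℓ_z⁻¹ ≤ Λ/ℓ_y`
  have h2 : ℓz⁻¹ ≤ Λ * ℓy⁻¹ := by
    rw [← div_eq_mul_inv, le_div_iff₀ hy]
    calc ℓz⁻¹ * ℓy ≤ ℓz⁻¹ * (Λ * ℓz) := mul_le_mul_of_nonneg_left hyz (inv_nonneg.2 hz.le)
      _ = Λ := by field_simp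
  have h12 := mul_le_mul h1 h2 (inv_nonneg.2 hz.le) (mul_nonneg (Real.rpow_nonneg hy.le _) hΛ0.le)
  calc ℓz ^ (-α) * ℓz⁻¹ ≤ ℓy ^ (-α) * Λ * (Λ * ℓy⁻¹) := h12
    _ = Λ ^ 2 * (ℓy ^ (-α) * ℓy ^ (-(1 : ℝ))) := by rw [Real.rpow_neg_one]; ring
    _ = Λ ^ 2 * ℓy ^ (-(1 + α)) := by rw [← Real.rpow_add hy]; ring_nf

/-- the t-cancellation of the Hölder quotient: for `t > 0`, `(t·ℓ)^{−α}·(t^α·X) = ℓ^{−α}·X` (`ℓ ≥ 0`). [cite: Balaban1984PropagatorsI, (1.109) p.35, bookkeeping] -/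
theorem quot_cancel {t ℓ α X : ℝ} (ht : 0 < t) (hℓ : 0 ≤ ℓ) : (t * ℓ) ^ (-α) * (t ^ α * X) = ℓ ^ (-α) * X := by
  rw [Real.mul_rpow ht.le hℓ, Real.rpow_neg ht.le]
  have : (t ^ α)⁻¹ * t ^ α = 1 := inv_mul_cancel₀ (Real.rpow_pos_of_pos ht α).ne'
  calc (t ^ α)⁻¹ * ℓ ^ (-α) * (t ^ α * X) = ((t ^ α)⁻¹ * t ^ α) * (ℓ ^ (-α) * X) := by ring
    _ = ℓ ^ (-α) * X := by rw [this, one_mul]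

section Torus

variable {m K : ℕ} {Mh k R : ℕ} {P' : Fin (d + 1) → ℕ}
variable (hN : ∀ μ, N0 ℓ Mh k P' μ = (PV d ℓ m K hd hL).sitesPerDir 0) (D : TDomains d ℓ Mh k P' R) (hk : k ≤ m + K)

/-- `L ≥ 1` (`L = ℓ + 1`). [cite: Balaban1984PropagatorsII, (2.1) p.224, bookkeeping] -/
private theorem one_le_L' : (1 : ℝ) ≤ (ℓ : ℝ) + 1 := by linarith [(Nat.cast_nonneg ℓ : (0 : ℝ) ≤ ℓ)]

/-- **ADJACENT BLOCKS LIE ON THE SAME OR ON CONSECUTIVE LEVELS** ((2.60) in the level-gap form `(R·L·M_h − 1)·(|j(z) − j(y)| − 1)₊ ≤ d_T(z, y)` of the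
tree's `B6Ineq2140KLevelV1.levelGap_le_dist`): if `d_T(z, y) ≤ 1` and `R·L·M_h ≥ 2L` then `j(z) ≤ j(y) + 1` and `j(y) ≤ j(z) + 1` (for `L = 1` all levels
have the same length and the claim is not needed; for `L ≥ 2`, `R·L·M_h − 1 ≥ 3` forces `(|j − j′| − 1)₊ ≤ ⅓`, i.e. `|j − j′| ≤ 1`).
[cite: Balaban1984PropagatorsII, (2.60) p.234, (2.2) p.224, bookkeeping] -/
theorem adjScale_le (hMh : 1 ≤ Mh) (hP : ∀ μ, 1 ≤ P' μ) (hRM2L : 2 * (ℓ + 1) ≤ R * ((ℓ + 1) * Mh)) (hℓ : 1 ≤ ℓ)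
    (y z : ↥(bset D.toDomains)) (hyz : (geomT D).dist z y ≤ 1) : z.1.1 ≤ y.1.1 + 1 ∧ y.1.1 ≤ z.1.1 + 1 := by
  have hgap := levelGap_le_dist D hMh hP z y
  have hN3 : 3 ≤ R * ((ℓ + 1) * Mh) - 1 := by omega
  have hN3r : (3 : ℝ) ≤ (((R * ((ℓ + 1) * Mh) - 1 : ℕ)) : ℝ) := by exact_mod_cast hN3
  have hmax0 : 0 ≤ max (|((z.1.1 : ℕ) : ℝ) - ((y.1.1 : ℕ) : ℝ)| - 1) 0 := le_max_right _ _
  have hmax : 3 * max (|((z.1.1 : ℕ) : ℝ) - ((y.1.1 : ℕ) : ℝ)| - 1) 0 ≤ 1 :=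
    le_trans (mul_le_mul_of_nonneg_right hN3r hmax0) (hgap.trans hyz)
  have habs : |((z.1.1 : ℕ) : ℝ) - ((y.1.1 : ℕ) : ℝ)| - 1 ≤ 1 / 3 := by
    have := le_max_left (|((z.1.1 : ℕ) : ℝ) - ((y.1.1 : ℕ) : ℝ)| - 1) 0
    linarith
  obtain ⟨h1, h2⟩ := abs_le.1 (show |((z.1.1 : ℕ) : ℝ) - ((y.1.1 : ℕ) : ℝ)| ≤ 4 / 3 by linarith)
  have hz2 : ((z.1.1 : ℕ) : ℝ) < ((y.1.1 : ℕ) : ℝ) + 2 := by linarith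
  have hy2 : ((y.1.1 : ℕ) : ℝ) < ((z.1.1 : ℕ) : ℝ) + 2 := by linarith
  have hz2' : z.1.1 < y.1.1 + 2 := by exact_mod_cast hz2
  have hy2' : y.1.1 < z.1.1 + 2 := by exact_mod_cast hy2
  exact ⟨by omega, by omega⟩

/-- **ADJACENT BLOCKS HAVE COMPARABLE LENGTHS**: `ℓ_z ≤ L·ℓ_y` for `ℓ_• = len_T(•)·|c_f|⁻¹`, `d_T(z, y) ≤ 1`, `R·L·M_h ≥ 2L`.
[cite: Balaban1984PropagatorsII, (2.60) p.234, (2.136)/(2.140) p.247 (the prefactors `Lʲη`), bookkeeping] -/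
theorem adjLen_le_L (hMh : 1 ≤ Mh) (hP : ∀ μ, 1 ≤ P' μ) (hRM2L : 2 * (ℓ + 1) ≤ R * ((ℓ + 1) * Mh)) (cf : ℝ)
    (y z : ↥(bset D.toDomains)) (hyz : (geomT D).dist z y ≤ 1) :
    (geomT D).len z * |cf|⁻¹ ≤ ((ℓ : ℝ) + 1) * ((geomT D).len y * |cf|⁻¹) := by
  have hL1 : (1 : ℝ) ≤ (ℓ : ℝ) + 1 := one_le_L'
  rw [lenT_eq, lenT_eq, ← mul_assoc, ← pow_succ']
  refine mul_le_mul_of_nonneg_right ?_ (inv_nonneg.2 (abs_nonneg _))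
  by_cases hℓ : ℓ = 0
  · subst hℓ; simp
  · exact pow_le_pow_right₀ hL1 (adjScale_le D hMh hP hRM2L (Nat.pos_of_ne_zero hℓ) y z hyz).1

/-- **ADJACENT BLOCKS, NATURAL POWERS**: `ℓ_z^p ≤ L^p·ℓ_y^p` (`d_T(z, y) ≤ 1`, `R·L·M_h ≥ 2L`) — the move of the prefactors `(Lʲη)²`, `Lʲη`, `1` of
(2.136)/(2.140) from the block of a fine bond to the adjacent census site. [cite: Balaban1984PropagatorsII, (2.60) p.234, (2.140) p.247, bookkeeping] -/
theorem adjLen_pow_le (hMh : 1 ≤ Mh) (hP : ∀ μ, 1 ≤ P' μ) (hRM2L : 2 * (ℓ + 1) ≤ R * ((ℓ + 1) * Mh)) (cf : ℝ) (p : ℕ)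
    (y z : ↥(bset D.toDomains)) (hyz : (geomT D).dist z y ≤ 1) :
    ((geomT D).len z * |cf|⁻¹) ^ p ≤ ((ℓ : ℝ) + 1) ^ p * ((geomT D).len y * |cf|⁻¹) ^ p := by
  rw [← mul_pow]
  exact pow_le_pow_left₀ (mul_nonneg (lenT_pos (D := D) z).le (inv_nonneg.2 (abs_nonneg _))) (adjLen_le_L D hMh hP hRM2L cf y z hyz) p

/-- **ADJACENT BLOCKS, THE (2.151) PREFACTOR**: `ℓ_z^{−α}ℓ_z⁻¹ ≤ (L²e)²·ℓ_y^{−(1+α)}` for `ℓ_• = len_T(•)·|c_f|⁻¹`, `d_T(z, y) ≤ 1`, `0 ≤ α ≤ 1`, under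
`R·L·M_h ≥ 2L` (`ℓ_y ≤ L·ℓ_z` by `adjScale_le`, then `len_compare`; the constant `(L²e)² ≥ L²` is the one first landed with the Cor. 2.8 census).
[cite: Balaban1984PropagatorsII, (2.60) p.234, (2.151) p.249, (2.2) p.224, bookkeeping] -/
theorem adjLen_le (hMh : 1 ≤ Mh) (hP : ∀ μ, 1 ≤ P' μ) (hRM2L : 2 * (ℓ + 1) ≤ R * ((ℓ + 1) * Mh)) {cf : ℝ} (hcf : cf ≠ 0)
    {α : ℝ} (hα0 : 0 ≤ α) (hα1 : α ≤ 1) (y z : ↥(bset D.toDomains)) (hyz : (geomT D).dist z y ≤ 1) :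
    ((geomT D).len z * |cf|⁻¹) ^ (-α) * ((geomT D).len z * |cf|⁻¹)⁻¹ ≤
      ((((ℓ : ℝ) + 1) ^ 2 * Real.exp 1) ^ 2) * ((geomT D).len y * |cf|⁻¹) ^ (-(1 + α)) := by
  have habs : 0 < |cf| := abs_pos.2 hcf
  have hLz := lenT_pos (D := D) z
  have hLy := lenT_pos (D := D) y
  have hL1 : (1 : ℝ) ≤ (ℓ : ℝ) + 1 := one_le_L'
  -- `ℓ_y ≤ L·ℓ_z` (the symmetric direction of `adjScale_le`)
  have hyz' : (geomT D).len y * |cf|⁻¹ ≤ ((ℓ : ℝ) + 1) * ((geomT D).len z * |cf|⁻¹) := by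
    rw [lenT_eq, lenT_eq, ← mul_assoc, ← pow_succ']
    refine mul_le_mul_of_nonneg_right ?_ (inv_nonneg.2 habs.le)
    by_cases hℓ : ℓ = 0
    · subst hℓ; simp
    · exact pow_le_pow_right₀ hL1 (adjScale_le D hMh hP hRM2L (Nat.pos_of_ne_zero hℓ) y z hyz).2
  have hmain := len_compare (mul_pos hLz (inv_pos.2 habs)) (mul_pos hLy (inv_pos.2 habs)) hL1 hyz' hα0 hα1
  refine hmain.trans (mul_le_mul_of_nonneg_right ?_ (Real.rpow_nonneg (mul_nonneg hLy.le (inv_nonneg.2 habs.le)) _))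
  -- `L² ≤ (L²e)²`
  have h1 : (1 : ℝ) ≤ ((ℓ : ℝ) + 1) ^ 2 * Real.exp 1 := one_le_mul_of_one_le_of_one_le (one_le_pow₀ hL1) (Real.one_le_exp (by norm_num))
  have h2 : ((ℓ : ℝ) + 1) ^ 2 ≤ ((ℓ : ℝ) + 1) ^ 2 * Real.exp 1 := le_mul_of_one_le_right (by positivity) (Real.one_le_exp (by norm_num))
  nlinarith

/-- **ADJACENT BLOCKS, THE (2.137) PREFACTOR** (positive power): `ℓ_z^{1−α} ≤ (L·e)·ℓ_y^{1−α}` for `d_T(z, y) ≤ 1`, `0 ≤ α ≤ 1`, `ℓ_• = len_T(•)·|c_f|⁻¹`,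
under `R·L·M_h ≥ 2L` (`ℓ_z ≤ L·ℓ_y` by `adjLen_le_L`; the constant `L·e ≥ L` is the one first verified with the (2.137) census).
[cite: Balaban1984PropagatorsII, (2.60) p.234, (2.137) p.247, (2.2) p.224, bookkeeping] -/
theorem adjLen_rpow_le (hMh : 1 ≤ Mh) (hP : ∀ μ, 1 ≤ P' μ) (hRM2L : 2 * (ℓ + 1) ≤ R * ((ℓ + 1) * Mh)) {cf : ℝ} (hcf : cf ≠ 0)
    {α : ℝ} (hα0 : 0 ≤ α) (hα1 : α ≤ 1) (y z : ↥(bset D.toDomains)) (hyz : (geomT D).dist z y ≤ 1) :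
    ((geomT D).len z * |cf|⁻¹) ^ (1 - α) ≤ (((ℓ : ℝ) + 1) * Real.exp 1) * ((geomT D).len y * |cf|⁻¹) ^ (1 - α) := by
  have habs : 0 < |cf| := abs_pos.2 hcf
  have hLz := lenT_pos (D := D) z
  have hLy := lenT_pos (D := D) y
  have hL1 : (1 : ℝ) ≤ (ℓ : ℝ) + 1 := one_le_L'
  set Λ : ℝ := (ℓ : ℝ) + 1 with hΛ
  have hzy' : (geomT D).len z * |cf|⁻¹ ≤ Λ * ((geomT D).len y * |cf|⁻¹) := adjLen_le_L D hMh hP hRM2L cf y z hyz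
  have hΛle : Λ ≤ ((ℓ : ℝ) + 1) * Real.exp 1 := le_mul_of_one_le_right (by positivity) (Real.one_le_exp (by norm_num))
  -- `ℓ_z^{1−α} ≤ (Λℓ_y)^{1−α} = Λ^{1−α}ℓ_y^{1−α} ≤ Λ·ℓ_y^{1−α}`
  have h0z : 0 ≤ (geomT D).len z * |cf|⁻¹ := by positivity
  have h0y : 0 ≤ (geomT D).len y * |cf|⁻¹ := by positivity
  calc ((geomT D).len z * |cf|⁻¹) ^ (1 - α) ≤ (Λ * ((geomT D).len y * |cf|⁻¹)) ^ (1 - α) :=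
        Real.rpow_le_rpow h0z hzy' (by linarith)
    _ = Λ ^ (1 - α) * ((geomT D).len y * |cf|⁻¹) ^ (1 - α) := Real.mul_rpow (by positivity) h0y
    _ ≤ Λ * ((geomT D).len y * |cf|⁻¹) ^ (1 - α) := by
        refine mul_le_mul_of_nonneg_right ?_ (Real.rpow_nonneg h0y _)
        calc Λ ^ (1 - α) ≤ Λ ^ (1 : ℝ) := Real.rpow_le_rpow_of_exponent_le hL1 (by linarith)
          _ = Λ := Real.rpow_one Λ
    _ ≤ (((ℓ : ℝ) + 1) * Real.exp 1) * ((geomT D).len y * |cf|⁻¹) ^ (1 - α) :=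
        mul_le_mul_of_nonneg_right hΛle (Real.rpow_nonneg h0y _)

/-- **THE TRIANGLE INEQUALITY (2.54) FOR AN ADJACENT BLOCK**: `d_T(z, w) ≥ d_T(y, w) − 1` when `d_T(z, y) ≤ 1`, in exponential form.
[cite: Balaban1984PropagatorsII, (2.54) p.232] -/
theorem exp_adj_le (hMh : 1 ≤ Mh) (hP : ∀ μ, 1 ≤ P' μ) {δ : ℝ} (hδ : 0 ≤ δ) (y z w : ↥(bset D.toDomains))
    (hyz : (geomT D).dist z y ≤ 1) :
    Real.exp (-(δ * (geomT D).dist z w)) ≤ Real.exp δ * Real.exp (-(δ * (geomT D).dist y w)) := by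
  obtain ⟨htri, -, -⟩ := triangle_refl_nonneg_T (D := D) hMh hP
  have h := htri y z w
  rw [← Real.exp_add]
  refine Real.exp_le_exp.2 ?_
  rw [symmT D y z] at h
  nlinarith

/-- bonds with the same direction at `ℓ^∞`-distance `0` coincide (the degenerate pair of the Hölder quotient). [cite: Balaban1984PropagatorsI, (1.109) p.35, bookkeeping] -/
theorem eq_of_supDist_eq_zero {x x' : PBond (PV d ℓ m K hd hL) 0} (hdir : x.dir = x'.dir) (hs : supDist x.src x'.src = 0) : x = x' := by
  obtain ⟨sx, dx⟩ := x
  obtain ⟨sx', dx'⟩ := x'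
  simp only at hdir hs
  have h := (supDist_eq_zero_iff sx sx').1 hs
  subst h; subst hdir; rfl

end Torus

end Literature.MathematicalPhysics.QuantumFieldTheory.Balaban1983to89.B6KLevelCensusBookkeepingV1

end
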